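import Mathlib.FieldTheory.Finite.Basic
import Mathlib.NumberTheory.RamificationInertia.Basic
import Literature.NumberTheory.GaloisRepresentations.ArtinFormalism
import Literature.NumberTheory.GaloisRepresentations.ArtinEulerFactorSpecProofs
import Literature.NumberTheory.GaloisRepresentations.ArtinLFunctionProofs
import Literature.NumberTheory.GaloisRepresentations.ArtinEulerProductProofs
import Literature.NumberTheory.GaloisRepresentations.FrobeniusGeneration
import Literature.NumberTheory.GaloisRepresentations.AbsIntegersEquiv
import Literature.RepresentationTheory.FiniteGroups.InducedInvariantsCharpolyInd
import HarnessLib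

/-!
# Induction invariance of Artin L-functions: proof of `artinLFunction_eq_of_isInducedFrom`
(Neukirch VII (10.4) (iv); companion to `Literature.NumberTheory.GaloisRepresentations.ArtinFormalism`)

D-0014 keeps `Literature/` sorry-free by stating cited results as named facts.  This file
**proves** the named fact `Literature.NumberTheory.GaloisRepresentations.artinLFunction_eq_of_isInducedFrom` of `ArtinFormalism`
(Neukirch, *Algebraic Number Theory*, VII (10.4) (iv): for a finite extension `M/K` of number
fields and an Artin representation `ρ ≅ Ind_{Γ_M}^{Γ_K} π`, `L(s, ρ) = L(s, π)` on `re s > 1`;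
Artin, Hamburg Abh. 8 (1931), §2), as `artinLFunction_eq_of_isInducedFrom_holds`, following
the printed proof (Neukirch VII, pp. 523–524):

1. **Local identity** (`ArtinRep.eulerFactorAt_eq_prod_expand_of_isInducedFrom`): for every
   finite place `v` of `K`,
   `L_v(ρ, T) = ∏_{w ∣ v} L_w(π, T^{f(w|v)})`, i.e.
   `det(1 - φt; V^{I_𝔓}) = ∏ᵢ det(1 - φᵢ t^{fᵢ}; W^{I'ᵢ})` (Neukirch p. 524).  The
   representation theory is `Literature.RepresentationTheory.FiniteGroups.reverse_charpoly_restrict_invariants_eq_prod_of_equiv_ind`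
   (`InducedInvariantsCharpolyInd`, for `ρ ≃ ind φ π` along
   `φ = absGaloisRestrict K M : Γ_M → Γ_K`, acting through the finite quotient
   `Γ_K / ker ρ`); the arithmetic inputs are: `G_𝔓 = ⟨φ⟩ I_𝔓 (ker ρ)`
   (`FrobeniusGeneration.exists_eq_frobenius_pow_mul_of_mem_decompositionSubgroup`); the
   double cosets `G_𝔓 \ Γ_K / Γ_M` correspond to the places `w ∣ v` of `M` via
   `τ ↦ ι(τ⁻¹ 𝔓) ∩ 𝓞 M` (transitivity of `Γ_K`, `Γ_M` on primes above a place,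
   `IntegralGaloisActionProofs`, and the equivariant isomorphism `\bar ℤ_K ≅ \bar ℤ_M`,
   `AbsIntegersEquiv`); a Frobenius `φ_w ∈ Γ_M` at `𝔔_w ∣ w` restricts to `φ^{f(w|v)}` modulo
   the inertia of `ι⁻¹ 𝔔_w = τ_w⁻¹ 𝔓`, and `f(w|v)` is the least such exponent
   (`inertiaDeg_dvd_of_forall_pow_residueCard_pow_eq`: the residue extension has cyclic Galois
   group of order `f` generated by the `q`-Frobenius); the Euler factors may be computed at
   any prime and Frobenius (`ArtinRep.eulerFactorAt_eq_eulerPolynomial`,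
   `ArtinEulerFactorSpecProofs`).
2. **Regrouping** (`artinLFunction_eq_of_isInducedFrom_holds`): evaluate at `T = N v^{-s}`,
   `(N v^{-s})^{f(w|v)} = N w^{-s}`, and `∏_v ∏_{w ∣ v} = ∏_w` for the unconditionally
   convergent Euler product (`multipliable_artinLFunction_holds`, Mathlib
   `Multipliable.tprod_sigma'`).

## References

* J. Neukirch, *Algebraic Number Theory*, Grundlehren 322 (1999), VII §10, Prop. (10.4) (iv)
  and its proof, pp. 522–524; I §9 (`NeukirchANT1999`).
* E. Artin, *Zur Theorie der L-Reihen mit allgemeinen Gruppencharakteren*, Abh. Math. Sem.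
  Univ. Hamburg 8 (1931), §2 (`ArtinHamburg1931`).
-/

noncomputable section

open scoped NumberField Pointwise
open Field IsDedekindDomain NumberField Module Polynomial

namespace Literature.NumberTheory.GaloisRepresentations

universe u u' w w'

/-! ### Arithmetic preliminaries: residue degrees, fibres of `w ↦ w ∩ 𝓞 K` -/

section Arithmetic

variable {K : Type u} [Field K] [NumberField K] {M : Type u'} [Field M] [NumberField M] [Algebra K M]

/-- **Residue degrees divide Frobenius exponents.**  Let `w ∣ v` be finite places of the
number fields `M ⊇ K`, `q = N v`, `f = f(w|v)`.  If `x ^ (q ^ m) = x` for every `x` in the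
residue field `𝓞 M ⧸ w`, then `f ∣ m`: the `q`-power Frobenius of the residue extension has
order exactly `f` (Mathlib `FiniteField.orderOf_frobeniusAlgHom`).
Ref: Neukirch, *Algebraic Number Theory*, VII §10, proof of (10.4) (iv), p. 523 ("`fᵢ` is the
smallest number such that `φ^{fᵢ} ∈ …`"); I §9 (9.4). [folklore] -/
theorem inertiaDeg_dvd_of_forall_pow_residueCard_pow_eq {v : HeightOneSpectrum (𝓞 K)}
    {w : HeightOneSpectrum (𝓞 M)} (hw : w.asIdeal.under (𝓞 K) = v.asIdeal) {m : ℕ}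
    (h : ∀ x : 𝓞 M ⧸ w.asIdeal, x ^ v.residueCard ^ m = x) :
    w.asIdeal.inertiaDeg (𝓞 K) ∣ m := by
  classical
  haveI : w.asIdeal.LiesOver v.asIdeal := ⟨hw.symm⟩
  haveI : v.asIdeal.IsMaximal := v.isMaximal
  haveI : w.asIdeal.IsMaximal := w.isMaximal
  letI : Field (𝓞 K ⧸ v.asIdeal) := Ideal.Quotient.field _
  letI : Field (𝓞 M ⧸ w.asIdeal) := Ideal.Quotient.field _
  haveI : Finite (𝓞 K ⧸ v.asIdeal) := v.asIdeal.finiteQuotientOfFreeOfNeBot v.ne_bot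
  haveI : Finite (𝓞 M ⧸ w.asIdeal) := w.asIdeal.finiteQuotientOfFreeOfNeBot w.ne_bot
  letI : Fintype (𝓞 K ⧸ v.asIdeal) := Fintype.ofFinite _
  have hq : Fintype.card (𝓞 K ⧸ v.asIdeal) = v.residueCard := by
    rw [Fintype.card_eq_nat_card, HeightOneSpectrum.residueCard_eq_card_quotient]
  have hf : w.asIdeal.inertiaDeg (𝓞 K) =
      Module.finrank (𝓞 K ⧸ v.asIdeal) (𝓞 M ⧸ w.asIdeal) :=
    Ideal.inertiaDeg_eq_of_isMaximal v.asIdeal w.asIdeal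
  rw [hf, ← FiniteField.orderOf_frobeniusAlgHom (𝓞 K ⧸ v.asIdeal) (𝓞 M ⧸ w.asIdeal)]
  refine orderOf_dvd_of_pow_eq_one (DFunLike.ext _ _ fun x => ?_)
  rw [AlgHom.coe_pow, FiniteField.coe_frobeniusAlgHom, pow_iterate, AlgHom.one_apply, hq]
  exact h x

/-- **`N w = (N v)^{f(w|v)}`** for finite places `w ∣ v` of `M ⊇ K` (Mathlib
`Ideal.inertiaDeg_eq_of_isMaximal`, `Module.natCard_eq_pow_finrank`; the `Type`-monomorphic
twin is `Literature.NumberTheory.Automorphic.residueCard_eq_pow_inertiaDeg`).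
Ref: Neukirch, *Algebraic Number Theory*, Ch. I §8. [folklore] -/
theorem residueCard_eq_pow_inertiaDeg_of_under_eq {v : HeightOneSpectrum (𝓞 K)}
    {w : HeightOneSpectrum (𝓞 M)} (hw : w.asIdeal.under (𝓞 K) = v.asIdeal) :
    w.residueCard = v.residueCard ^ w.asIdeal.inertiaDeg (𝓞 K) := by
  rw [HeightOneSpectrum.residueCard_eq_card_quotient,
    HeightOneSpectrum.residueCard_eq_card_quotient]
  haveI : w.asIdeal.IsMaximal := w.isMaximal
  haveI : v.asIdeal.IsMaximal := v.isMaximal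
  haveI : w.asIdeal.LiesOver v.asIdeal := ⟨hw.symm⟩
  letI : Field (𝓞 K ⧸ v.asIdeal) := Ideal.Quotient.field _
  rw [Ideal.inertiaDeg_eq_of_isMaximal v.asIdeal w.asIdeal,
    Module.natCard_eq_pow_finrank (K := 𝓞 K ⧸ v.asIdeal)]

/-- There are finitely many finite places of `M` above a finite place `v` of `K` (they inject
into Mathlib's finite set `Ideal.primesOver`; the `Type`-monomorphic twin is
`Literature.NumberTheory.Automorphic.finite_placesOver`). [folklore] -/
theorem finite_heightOneSpectrum_under_eq (v : HeightOneSpectrum (𝓞 K)) :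
    Finite {w : HeightOneSpectrum (𝓞 M) // w.under (𝓞 K) = v} := by
  haveI : v.asIdeal.IsMaximal := v.isMaximal
  haveI : Finite (v.asIdeal.primesOver (𝓞 M)) :=
    (IsDedekindDomain.primesOver_finite v.asIdeal (𝓞 M)).to_subtype
  refine Finite.of_injective (fun w : {w : HeightOneSpectrum (𝓞 M) // w.under (𝓞 K) = v} =>
    (⟨w.1.asIdeal, w.1.isPrime, ⟨(congrArg HeightOneSpectrum.asIdeal w.2).symm⟩⟩ :
      v.asIdeal.primesOver (𝓞 M))) fun w w' h => ?_
  exact Subtype.ext (HeightOneSpectrum.ext (congrArg (fun P : v.asIdeal.primesOver (𝓞 M) =>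
    (P : Ideal (𝓞 M))) h))

end Arithmetic

/-! ### Frobenius bookkeeping in `Γ_K` -/

section Frobenius

variable {K : Type u} [Field K]

/-- If `g` acts on `\bar ℤ_K / 𝔓` as `x ↦ x^n`, then `τ g τ⁻¹` acts on `\bar ℤ_K / τ𝔓` as
`x ↦ x^n`. Ref: Neukirch, *Algebraic Number Theory*, I §9 (conjugate Frobenii). [folklore] -/
theorem forall_conj_smul_sub_pow_mem_smul {𝔓 : Ideal (absIntegers (𝓞 K) K)}
    {g : absoluteGaloisGroup K} {n : ℕ} (h : ∀ x : absIntegers (𝓞 K) K, g • x - x ^ n ∈ 𝔓)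
    (τ : absoluteGaloisGroup K) (x : absIntegers (𝓞 K) K) :
    (τ * g * τ⁻¹) • x - x ^ n ∈ τ • 𝔓 := by
  have hx : (τ * g * τ⁻¹) • x - x ^ n = τ • (g • (τ⁻¹ • x) - (τ⁻¹ • x) ^ n) := by
    rw [smul_sub, smul_pow', smul_inv_smul, mul_smul, mul_smul]
  rw [hx]
  exact Ideal.smul_mem_pointwise_smul_iff.mpr (h _)

/-- Two elements acting on `\bar ℤ_K / 𝔓` by the same power map differ by inertia:
`g g'⁻¹ ∈ I_𝔓` (cf. Mathlib `IsArithFrobAt.mul_inv_mem_inertia` for `n = q`).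
Ref: Neukirch, *Algebraic Number Theory*, I §9, (9.6). [folklore] -/
theorem mul_inv_mem_inertia_of_forall_smul_sub_pow_mem {𝔓 : Ideal (absIntegers (𝓞 K) K)}
    {g g' : absoluteGaloisGroup K} {n : ℕ} (hg : ∀ x : absIntegers (𝓞 K) K, g • x - x ^ n ∈ 𝔓)
    (hg' : ∀ x : absIntegers (𝓞 K) K, g' • x - x ^ n ∈ 𝔓) :
    g * g'⁻¹ ∈ 𝔓.inertia (absoluteGaloisGroup K) := by
  intro x
  change (g * g'⁻¹) • x - x ∈ 𝔓
  have h1 := hg (g'⁻¹ • x)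
  have h2 := hg' (g'⁻¹ • x)
  rw [smul_inv_smul] at h2
  rw [mul_smul]
  have := sub_mem h1 h2
  rwa [sub_sub_sub_cancel_right] at this

/-- An element of inertia followed by an `n`-th power Frobenius is an `n`-th power Frobenius:
if `y ∈ I_𝔓` and `g • x ≡ x^n (mod 𝔓)` for all `x`, then `(g y) • x ≡ x^n (mod 𝔓)`.
Ref: Neukirch, *Algebraic Number Theory*, I §9, (9.6). [folklore] -/
theorem forall_mul_smul_sub_pow_mem_of_mem_inertia {𝔓 : Ideal (absIntegers (𝓞 K) K)}
    [𝔓.IsPrime] {g y : absoluteGaloisGroup K} {n : ℕ}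
    (hg : ∀ x : absIntegers (𝓞 K) K, g • x - x ^ n ∈ 𝔓)
    (hy : y ∈ 𝔓.inertia (absoluteGaloisGroup K)) (hgD : g • 𝔓 = 𝔓) (x : absIntegers (𝓞 K) K) :
    (g * y) • x - x ^ n ∈ 𝔓 := by
  have h1 : g • (y • x - x) ∈ 𝔓 := by
    rw [← hgD]
    exact Ideal.smul_mem_pointwise_smul_iff.mpr (hy x)
  rw [smul_sub] at h1
  have := add_mem h1 (hg x)
  rw [mul_smul]
  rwa [sub_add_sub_cancel] at this

/-- `x ∈ τ⁻¹ I τ ↔ τ x τ⁻¹ ∈ I`: the preimage of `I_𝔓` under conjugation by `τ` is the inertia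
group of `τ⁻¹ 𝔓` (`absIntegers.inertia_smul`). [folklore] -/
theorem inertia_comap_conj_eq (𝔓 : Ideal (absIntegers (𝓞 K) K)) (τ : absoluteGaloisGroup K) :
    (𝔓.inertia (absoluteGaloisGroup K)).comap (MulAut.conj τ).toMonoidHom =
      (τ⁻¹ • 𝔓).inertia (absoluteGaloisGroup K) := by
  rw [absIntegers.inertia_smul]
  ext x
  rw [Subgroup.mem_comap, Subgroup.mem_pointwise_smul_iff_inv_smul_mem, map_inv, inv_inv]
  rfl

end Frobenius

/-! ### The index of `Gal(K̄/M)` in `Γ_K` -/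

section GaloisIndex

variable (K : Type u) (M : Type u') [Field K] [Field M] [Algebra K M] [FiniteDimensional K M]
  [CharZero K]

/-- **`[Γ_K : Gal(K̄/M)] = [M : K]`** for a finite extension `M/K` of fields of characteristic
`0`: the image of the restriction `Γ_M → Γ_K` is the fixing subgroup of the subfield
`e(M) ⊆ K̄` (`exists_mem_range_absGaloisRestrict_iff`), whose index is `[e(M) : K]`
(Mathlib `IntermediateField.finrank_eq_fixingSubgroup_index`).  (Same statement as the index
half of `Literature.NumberTheory.Automorphic.isOpen_range_absGaloisRestrict_and_index` of
`Literature.NumberTheory.Automorphic.LanglandsTetrahedral`, repeated here to keep this file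
inside the Galois-representation topic.)
Ref: Neukirch, *Algebraic Number Theory*, Ch. IV §1 (infinite Galois theory). [folklore] -/
theorem index_range_absGaloisRestrict_eq_finrank :
    (absGaloisRestrict K M).range.index = Module.finrank K M := by
  obtain ⟨e, he⟩ := exists_mem_range_absGaloisRestrict_iff K M
  have hK' : (absGaloisRestrict K M).range =
      (e.fieldRange.fixingSubgroup : Subgroup (absoluteGaloisGroup K)) := by
    ext g
    refine (he g).trans (Iff.trans ?_ (mem_fixingSubgroup_iff_forall_smul e.fieldRange g).symm)
    constructor
    · rintro h ⟨x, ⟨k, rfl⟩⟩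
      exact h k
    · intro h k
      exact h ⟨e k, ⟨k, rfl⟩⟩
  haveI : FiniteDimensional K e.fieldRange :=
    LinearEquiv.finiteDimensional e.equivFieldRange.toLinearEquiv
  rw [hK', e.equivFieldRange.toLinearEquiv.finrank_eq]
  exact (IntermediateField.finrank_eq_fixingSubgroup_index e.fieldRange).symm

/-- The image of `Γ_M → Γ_K` has finite index (`M/K` finite, characteristic `0`). [folklore] -/
theorem finiteIndex_range_absGaloisRestrict : (absGaloisRestrict K M).range.FiniteIndex :=
  ⟨by rw [index_range_absGaloisRestrict_eq_finrank]; exact Module.finrank_pos.ne'⟩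

end GaloisIndex

/-! ### The local identity -/

section Local

variable {K : Type u} [Field K] [NumberField K] {M : Type u'} [Field M] [NumberField M] [Algebra K M]
  {V : Type w} [AddCommGroup V] [Module ℂ V] [TopologicalSpace V] [FiniteDimensional ℂ V]
  {W : Type w'} [AddCommGroup W] [Module ℂ W] [TopologicalSpace W] [FiniteDimensional ℂ W]

-- One long proof with many local definitions (`set`/`choose`): the default limits are slightly
-- too small for the elaboration of the double-coset bookkeeping.
set_option maxHeartbeats 400000 in
set_option synthInstance.maxHeartbeats 80000 in
/-- **Neukirch VII (10.4) (iv), local form: the Euler factor of an induced Artin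
representation.**  Let `M/K` be an extension of number fields, `ρ` an Artin representation of
`K` (module topology) induced (`ArtinRep.IsInducedFrom`) from the Artin representation `π` of
`M`, and `v` a finite place of `K`.  Then
`L_v(ρ, T) = ∏_{w ∣ v} L_w(π, T^{f(w|v)})`,
the product over the places `w` of `M` above `v`, `f(w|v)` the residue degree
(`Ideal.inertiaDeg`, `Polynomial.expand`): this is
`det(1 - φt; V^{I_𝔓}) = ∏ᵢ det(1 - φᵢ t^{fᵢ}; W^{I'ᵢ})` of Neukirch's proof (VII, p. 524), for
the tree's `ArtinRep.eulerFactorAt`.  Proof: module docstring, step 1.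
[cite: NeukirchANT1999, VII (10.4) (iv), proof pp. 523–524] [cite: ArtinHamburg1931, §2] -/
theorem ArtinRep.eulerFactorAt_eq_prod_expand_of_isInducedFrom [IsModuleTopology ℂ V]
    (ρ : ArtinRep K V) (π : ArtinRep M W) (h : ρ.IsInducedFrom π) (v : HeightOneSpectrum (𝓞 K))
    [Fintype {w : HeightOneSpectrum (𝓞 M) // w.under (𝓞 K) = v}] :
    ρ.eulerFactorAt v = ∏ w : {w : HeightOneSpectrum (𝓞 M) // w.under (𝓞 K) = v},
      expand ℂ (w.1.asIdeal.inertiaDeg (𝓞 K)) (π.eulerFactorAt w.1) := by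
  classical
  obtain ⟨e⟩ := h
  -- the groups and the restriction map
  haveI : FiniteDimensional K M := Module.Finite.right ℚ K M
  set res : absoluteGaloisGroup M →* absoluteGaloisGroup K := (absGaloisRestrict K M).toMonoidHom
    with hres
  have hresa : ∀ γ, res γ = absGaloisRestrict K M γ := fun _ => rfl
  have hinj : Function.Injective res := absGaloisRestrict_injective K M
  haveI : res.range.FiniteIndex := finiteIndex_range_absGaloisRestrict K M
  -- the kernel of `ρ`
  haveI : Finite (absoluteGaloisGroup K ⧸ ρ.ker) :=
    Subgroup.quotient_finite_of_isOpen _ ρ.isOpen_ker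
  haveI : ρ.ker.FiniteIndex := Subgroup.finiteIndex_of_finite_quotient
  haveI : ρ.ker.Normal := MonoidHom.normal_ker ρ.toRepresentation
  have hNσ : ∀ n ∈ ρ.ker, ρ.toRepresentation n = 1 := fun n hn => hn
  -- the prime `𝔓 ∣ v`, its decomposition and inertia groups, a Frobenius `fr`
  obtain ⟨𝔓, h𝔓⟩ := v.primesAbove_nonempty
  obtain ⟨fr, hfr⟩ := HeightOneSpectrum.exists_isArithFrobAt_of_mem_primesAbove_holds h𝔓
  haveI h𝔓p : 𝔓.IsPrime := h𝔓.1
  set D : Subgroup (absoluteGaloisGroup K) := 𝔓.decompositionSubgroup (absoluteGaloisGroup K)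
    with hD
  set I : Subgroup (absoluteGaloisGroup K) := 𝔓.inertia (absoluteGaloisGroup K) with hI
  have hID : I ≤ D := Ideal.inertia_le_decompositionSubgroup _ _
  have hIn : ∀ d ∈ D, ∀ y ∈ I, d⁻¹ * y * d ∈ I := fun d hd y hy =>
    Ideal.inv_mul_mul_mem_inertia hd hy
  have hfrD : fr ∈ D := hfr.mem_stabilizer
  have hfr' := (HeightOneSpectrum.isArithFrobAt_iff_of_mem_primesAbove h𝔓 fr).mp hfr
  -- `D = ⟨fr⟩ I (ker ρ)`
  have hgen : ∀ d ∈ D, ∃ a : ℕ, ∃ y ∈ I, (fr ^ a * y)⁻¹ * d ∈ ρ.ker := by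
    intro d hd
    obtain ⟨n, i, u, hi, hu, rfl⟩ :=
      exists_eq_frobenius_pow_mul_of_mem_decompositionSubgroup h𝔓 hfr ρ.isOpen_ker hd
    refine ⟨n, i, hi, ?_⟩
    rwa [show (fr ^ n * i)⁻¹ * (fr ^ n * i * u) = u by group]
  -- per place `w ∣ v`: a prime `𝔔_w ∣ w` of `\bar ℤ_M`, a Frobenius `s_w`, and `τ_w ∈ Γ_K`
  -- with `ι⁻¹ 𝔔_w = τ_w⁻¹ 𝔓`
  set ι := absIntegersMap K M with hι
  have hwv : ∀ w : {w : HeightOneSpectrum (𝓞 M) // w.under (𝓞 K) = v},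
      w.1.asIdeal.under (𝓞 K) = v.asIdeal := fun w => congrArg HeightOneSpectrum.asIdeal w.2
  have hdata : ∀ w : {w : HeightOneSpectrum (𝓞 M) // w.under (𝓞 K) = v},
      ∃ 𝔔 : Ideal (absIntegers (𝓞 M) M), ∃ s : absoluteGaloisGroup M,
        ∃ τ : absoluteGaloisGroup K, 𝔔 ∈ w.1.primesAbove ∧ IsArithFrobAt (𝓞 M) s 𝔔 ∧
          τ • 𝔔.comap ι = 𝔓 := by
    intro w
    obtain ⟨𝔔, h𝔔⟩ := w.1.primesAbove_nonempty
    obtain ⟨s, hs⟩ := HeightOneSpectrum.exists_isArithFrobAt_of_mem_primesAbove_holds h𝔔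
    obtain ⟨τ, hτ⟩ := HeightOneSpectrum.exists_smul_eq_of_mem_primesAbove_holds
      (comap_absIntegersMap_mem_primesAbove (hwv w) h𝔔) h𝔓
    exact ⟨𝔔, s, τ, h𝔔, hs, hτ⟩
  choose 𝔔 s τ h𝔔 hs hτ using hdata
  have h𝔔p : ∀ w, (𝔔 w).IsPrime := fun w => (h𝔔 w).1
  have hcomap : ∀ w, (𝔔 w).comap ι = (τ w)⁻¹ • 𝔓 := fun w => by
    rw [← hτ w, inv_smul_smul]
  have hunder : ∀ w, (𝔔 w).under (𝓞 M) = w.1.asIdeal := fun w => (h𝔔 w).2.over.symm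
  -- the subgroups `res⁻¹(τ_w⁻¹ I τ_w) = I_{𝔔_w}`
  have hJ : ∀ w, (I.comap (MulAut.conj (τ w)).toMonoidHom).comap res =
      (𝔔 w).inertia (absoluteGaloisGroup M) := fun w => by
    rw [hI, inertia_comap_conj_eq, ← hcomap w, hres]
    exact comap_inertia_comap_absIntegersMap K M (𝔔 w)
  have hinvJ : ∀ w, Representation.invariants (π.toRepresentation.comp
      ((I.comap (MulAut.conj (τ w)).toMonoidHom).comap res).subtype) =
        π.fixedSubmodule ((𝔔 w).inertia (absoluteGaloisGroup M)) := fun w =>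
    congrArg (fun S : Subgroup (absoluteGaloisGroup M) =>
      Representation.invariants (π.toRepresentation.comp S.subtype)) (hJ w)
  -- double cosets: covering
  have h1 : ∀ x : absoluteGaloisGroup K, ∃ w, ∃ d ∈ D, ∃ g : absoluteGaloisGroup M,
      x = d * τ w * res g := by
    intro x
    have h𝔓x : x⁻¹ • 𝔓 ∈ v.primesAbove := smul_mem_primesAbove h𝔓 x⁻¹
    set 𝔔x : Ideal (absIntegers (𝓞 M) M) :=
      (x⁻¹ • 𝔓).comap ((absIntegersEquiv K M).symm : absIntegers (𝓞 M) M →+* absIntegers (𝓞 K) K)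
      with h𝔔x
    have h𝔔xc : 𝔔x.comap ι = x⁻¹ • 𝔓 := by
      rw [h𝔔x, hι, ← coe_absIntegersEquiv]
      exact Ideal.comap_of_equiv _
    haveI : 𝔔x.IsPrime := by
      haveI := h𝔓x.1
      exact Ideal.comap_isPrime _ _
    have h𝔔xv : 𝔔x.comap (absIntegersMap K M) ∈ v.primesAbove := by rw [← hι, h𝔔xc]; exact h𝔓x
    obtain ⟨w₀, hw₀, h𝔔xw, -⟩ :=
      exists_heightOneSpectrum_of_comap_absIntegersMap_mem_primesAbove h𝔔xv
    let w : {w : HeightOneSpectrum (𝓞 M) // w.under (𝓞 K) = v} := ⟨w₀, HeightOneSpectrum.ext hw₀⟩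
    obtain ⟨γ, hγ⟩ := HeightOneSpectrum.exists_smul_eq_of_mem_primesAbove_holds h𝔔xw (h𝔔 w)
    -- `res γ • x⁻¹ 𝔓 = τ_w⁻¹ 𝔓`
    have key : (res γ * x⁻¹) • 𝔓 = (τ w)⁻¹ • 𝔓 := by
      rw [mul_smul, ← h𝔔xc, hresa, ← comap_absIntegersMap_smul, hγ, ← hι, hcomap w]
    have hd : τ w * res γ * x⁻¹ ∈ D := by
      rw [hD, Ideal.mem_decompositionSubgroup_iff, mul_assoc, mul_smul, key, smul_inv_smul]
    exact ⟨w, (τ w * res γ * x⁻¹)⁻¹, D.inv_mem hd, γ, by group⟩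
  -- double cosets: disjointness
  have h2 : ∀ i j, (∃ d ∈ D, ∃ g : absoluteGaloisGroup M, τ j = d * τ i * res g) → i = j := by
    rintro i j ⟨d, hd, g, hEq⟩
    have hd' : d⁻¹ • 𝔓 = 𝔓 := by
      rw [inv_smul_eq_iff]
      exact (Ideal.mem_decompositionSubgroup_iff.mp hd).symm
    have hij : (𝔔 j).comap ι = (g⁻¹ • 𝔔 i).comap ι := by
      rw [hι, comap_absIntegersMap_smul, ← hι, hcomap i, hcomap j, hEq, mul_inv_rev, mul_inv_rev,
        mul_smul, mul_smul, hd', map_inv, hresa]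
    have hQ : 𝔔 j = g⁻¹ • 𝔔 i :=
      Ideal.comap_injective_of_surjective _ (absIntegersMap_surjective K M) hij
    apply Subtype.ext
    apply HeightOneSpectrum.ext
    rw [← hunder i, ← hunder j, hQ, under_smul_absIntegers]
  -- the Frobenii upstairs: `res s_w ∈ τ_w⁻¹ fr^{f_w} I τ_w`
  set f : {w : HeightOneSpectrum (𝓞 M) // w.under (𝓞 K) = v} → ℕ :=
    fun w => w.1.asIdeal.inertiaDeg (𝓞 K) with hf
  have hqw : ∀ w, w.1.residueCard = v.residueCard ^ f w := fun w =>
    residueCard_eq_pow_inertiaDeg_of_under_eq (hwv w)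
  have hsK : ∀ w (x : absIntegers (𝓞 K) K),
      res (s w) • x - x ^ v.residueCard ^ f w ∈ (τ w)⁻¹ • 𝔓 := by
    intro w
    rw [← hcomap w, ← hqw w, hι, hresa]
    exact (forall_smul_sub_pow_mem_comap_iff K M (𝔔 w) (s w) _).mpr
      ((HeightOneSpectrum.isArithFrobAt_iff_of_mem_primesAbove (h𝔔 w) (s w)).mp (hs w))
  have hs' : ∀ w, ∃ y ∈ I, res (s w) = (τ w)⁻¹ * (fr ^ f w * y * τ w) := by
    intro w
    refine Literature.RepresentationTheory.FiniteGroups.exists_eq_inv_mul_pow_mul_of_mem hIn hfrD ?_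
    -- `τ (res s) τ⁻¹` and `fr ^ f` both act on `\bar ℤ_K / 𝔓` as `x ↦ x ^ (q ^ f)`
    have h1' : ∀ x : absIntegers (𝓞 K) K,
        (τ w * res (s w) * (τ w)⁻¹) • x - x ^ v.residueCard ^ f w ∈ 𝔓 := fun x => by
      have := forall_conj_smul_sub_pow_mem_smul (hsK w) (τ w) x
      rwa [smul_inv_smul] at this
    exact mul_inv_mem_inertia_of_forall_smul_sub_pow_mem h1'
      (pow_smul_sub_pow_mem_of_isArithFrobAt h𝔓 hfr (f w))
  -- minimality of `f_w`
  have hf' : ∀ w (m : ℕ), (∃ y ∈ I, ∃ g : absoluteGaloisGroup M,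
      res g = (τ w)⁻¹ * (fr ^ m * y * τ w)) → f w ∣ m := by
    rintro w m ⟨y, hy, g, hg⟩
    -- `res g` acts on `\bar ℤ_K / τ_w⁻¹ 𝔓` as `x ↦ x ^ (q ^ m)`
    have hfrm : ∀ x : absIntegers (𝓞 K) K, (fr ^ m * y) • x - x ^ v.residueCard ^ m ∈ 𝔓 :=
      forall_mul_smul_sub_pow_mem_of_mem_inertia (pow_smul_sub_pow_mem_of_isArithFrobAt h𝔓 hfr m)
        hy (Ideal.mem_decompositionSubgroup_iff.mp (D.pow_mem hfrD m))
    have hgK : ∀ x : absIntegers (𝓞 K) K, res g • x - x ^ v.residueCard ^ m ∈ (τ w)⁻¹ • 𝔓 := by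
      intro x
      have := forall_conj_smul_sub_pow_mem_smul hfrm (τ w)⁻¹ x
      rw [inv_inv, mul_assoc] at this
      rwa [← hg] at this
    -- transport to `\bar ℤ_M / 𝔔_w` and restrict to `𝓞 M`
    have hgM : ∀ z : absIntegers (𝓞 M) M, g • z - z ^ v.residueCard ^ m ∈ 𝔔 w := by
      rw [← forall_smul_sub_pow_mem_comap_iff K M (𝔔 w) g, ← hι, hcomap w]
      exact fun x => hgK x
    refine inertiaDeg_dvd_of_forall_pow_residueCard_pow_eq (hwv w) fun x => ?_
    obtain ⟨r, rfl⟩ := Ideal.Quotient.mk_surjective x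
    rw [← map_pow, Ideal.Quotient.eq, ← hunder w, Ideal.under, Ideal.mem_comap, map_sub, map_pow]
    have := hgM (algebraMap (𝓞 M) (absIntegers (𝓞 M) M) r)
    rw [smul_algebraMap] at this
    rw [← neg_mem_iff, neg_sub]
    exact this
  -- stability of the fixed spaces
  have hA : Set.MapsTo (ρ.toRepresentation fr)
      ↑(Representation.invariants (ρ.toRepresentation.comp I.subtype))
      ↑(Representation.invariants (ρ.toRepresentation.comp I.subtype)) :=
    Literature.RepresentationTheory.FiniteGroups.mapsTo_invariants_of_conj_mem ρ.toRepresentation I fun j hj => hIn fr hfrD j hj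
  have hB : ∀ w, Set.MapsTo (π.toRepresentation (s w))
      ↑(Representation.invariants (π.toRepresentation.comp
        ((I.comap (MulAut.conj (τ w)).toMonoidHom).comap res).subtype))
      ↑(Representation.invariants (π.toRepresentation.comp
        ((I.comap (MulAut.conj (τ w)).toMonoidHom).comap res).subtype)) := fun w => by
    rw [hinvJ w]
    haveI := h𝔔p w
    exact Literature.RepresentationTheory.FiniteGroups.mapsTo_invariants_of_conj_mem π.toRepresentation _ fun j hj =>
      Ideal.inv_mul_mul_mem_inertia (hs w).mem_stabilizer hj
  -- Artin's theorem
  have main := Literature.RepresentationTheory.FiniteGroups.reverse_charpoly_restrict_invariants_eq_prod_of_equiv_ind res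
    π.toRepresentation ρ.toRepresentation τ f s ρ.ker e hinj hNσ hID hIn hfrD hgen h1 h2 hs' hf'
    hA hB
  -- identification of both sides with Euler factors
  rw [ArtinRep.eulerFactorAt_eq_eulerPolynomial ρ h𝔓 hfr]
  have lhs : ρ.eulerPolynomial 𝔓 ⟨fr, hfrD⟩ =
      ((ρ.toRepresentation fr).restrict hA).charpoly.reverse := rfl
  rw [lhs, main]
  refine Finset.prod_congr rfl fun w _ => ?_
  haveI := h𝔔p w
  rw [ArtinRep.eulerFactorAt_eq_eulerPolynomial π (h𝔔 w) (hs w), ArtinRep.eulerPolynomial]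
  congr 2
  exact Literature.RepresentationTheory.FiniteGroups.charpoly_restrict_congr (hinvJ w) rfl _ _

end Local

/-! ### The discharge -/

section Global

variable {K : Type u} [Field K] [NumberField K] {M : Type u'} [Field M] [NumberField M] [Algebra K M]
  {V : Type w} [AddCommGroup V] [Module ℂ V] [TopologicalSpace V] [FiniteDimensional ℂ V]
  {W : Type w'} [AddCommGroup W] [Module ℂ W] [TopologicalSpace W] [FiniteDimensional ℂ W]

/-- **Discharge of `artinLFunction_eq_of_isInducedFrom` (Neukirch VII (10.4) (iv): Artin
L-functions are invariant under induction).**  For a finite extension `M/K` of number fields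
and an Artin representation `ρ` of `K` induced from the Artin representation `π` of `M`
(module topologies), `L(s, ρ) = L(s, π)` for `re s > 1`.  Proof: the local identity
`L_v(ρ, T) = ∏_{w ∣ v} L_w(π, T^{f(w|v)})` (`ArtinRep.eulerFactorAt_eq_prod_expand_of_isInducedFrom`)
at `T = N v^{-s}`, `N w = N v^{f(w|v)}`, and the regrouping `∏_v ∏_{w ∣ v} = ∏_w` of the
unconditionally convergent Euler product of `π` (`multipliable_artinLFunction_holds`).
[cite: NeukirchANT1999, VII (10.4) (iv)] [cite: ArtinHamburg1931, §2] -/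
theorem artinLFunction_eq_of_isInducedFrom_holds :
    artinLFunction_eq_of_isInducedFrom (K := K) (M := M) (V := V) (W := W) := by
  intro _ _ ρ π h s hs
  classical
  haveI hfin : ∀ v : HeightOneSpectrum (𝓞 K),
      Fintype {w : HeightOneSpectrum (𝓞 M) // w.under (𝓞 K) = v} := fun v =>
    @Fintype.ofFinite _ (finite_heightOneSpectrum_under_eq v)
  -- the Euler factors of `π`, regrouped by the place of `K` below
  set F : HeightOneSpectrum (𝓞 M) → ℂ := fun w =>
    ((π.eulerFactorAt w).eval ((w.residueCard : ℂ) ^ (-s)))⁻¹ with hF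
  set eσ := Equiv.sigmaFiberEquiv fun w : HeightOneSpectrum (𝓞 M) => w.under (𝓞 K) with heσ
  have hmul : Multipliable (F ∘ eσ) :=
    (Equiv.multipliable_iff eσ).mpr (multipliable_artinLFunction_holds π hs)
  have h₁ : ∀ v : HeightOneSpectrum (𝓞 K),
      Multipliable fun c : {w : HeightOneSpectrum (𝓞 M) // w.under (𝓞 K) = v} =>
        (F ∘ eσ) ⟨v, c⟩ := fun v => Multipliable.of_finite
  have hsig := Multipliable.tprod_sigma' h₁ hmul
  -- the local identity, evaluated at `T = N v ^ (-s)`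
  have hloc : ∀ v : HeightOneSpectrum (𝓞 K),
      ((ρ.eulerFactorAt v).eval ((v.residueCard : ℂ) ^ (-s)))⁻¹ =
        ∏ w : {w : HeightOneSpectrum (𝓞 M) // w.under (𝓞 K) = v}, F w.1 := by
    intro v
    rw [ArtinRep.eulerFactorAt_eq_prod_expand_of_isInducedFrom ρ π h v, eval_prod,
      ← Finset.prod_inv_distrib]
    refine Finset.prod_congr rfl fun w _ => ?_
    rw [hF, expand_eval]
    dsimp only
    rw [residueCard_eq_pow_inertiaDeg_of_under_eq (congrArg HeightOneSpectrum.asIdeal w.2),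
      Nat.cast_pow, ← Complex.natCast_cpow_natCast_mul, Complex.cpow_nat_mul]
  unfold artinLFunction
  rw [← Equiv.tprod_eq eσ F]
  change ∏' v, ((ρ.eulerFactorAt v).eval ((v.residueCard : ℂ) ^ (-s)))⁻¹ = ∏' c, (F ∘ eσ) c
  rw [hsig]
  refine tprod_congr fun v => ?_
  rw [hloc v, tprod_fintype]
  rfl

end Global

end Literature.NumberTheory.GaloisRepresentations
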